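import Summits.PneNP.PneNP.Theses.RootDecompExplicitRandom
import Literature.Computability.Complexity.BoolEncodings

/-!
# `RootDecompExplicitRandom.BottomRefuted33` (stmt-PneNP-31308) — the decided costume cell `(id, 3, 3)`

Node N28 of the decomp-pnenp root-decomposition cell (route `route-PneNP-RootDecompExplicitRandom`) records,
as an aside, the DECIDED cell just below its notch `(a, b) = (3, 4)` on the explicit-construction dial: no
fixed program `e` of the standard clocked interpreter, fed the binary numeral of `n` and run `n ^ 3`
rounds, prints for all large `n` an `n`-bit string `x` with `K^{n^3}(x) ≥ n` — because the constructing
program `⟨e, bin n⟩` is ITSELF a description of `x` of length `2|e| + 2 + (⌊log₂ n⌋ + 1) < n` printing `x`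
within `n ^ 3` rounds (S-agnostic counting + simulation law; Li–Vitányi Thm 2.2.1).  Direct port of the
lens-3 g7 chain `ktAt_le_of_run` / `not_explicitOn_of_le` / `log_add_lt_id` / `not_explicitStd_id_of_le`
(ExplicitRandomDial.lean 36e603a8) against the route file's inlined infimum, certified closable by the
cell critic's anchor probe Anchor_N28_ExplicitRandom.lean ecd15bc1 (`tree_bottomRefuted33_holds`,
2026-08-30T08:49:16Z).  Uses only `length_boolPair` (`BoolEncodings`) and `Nat.length_digits`.  0 sorry.
-/

namespace Summit.PneNP.PneNP.Theorems

open Literature.Computability.Complexity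

/-- `BottomRefuted33` (stmt-PneNP-31308): `¬ ∃ e n₀, ∀ n ≥ n₀, ∃ x, ClockedUS.run ⟨e, bin n⟩ (n^3) = some x ∧
|x| = n ∧ n ≤ K^{n^3}_{ClockedUS}(x)` — at `n := max n₀ 2^{2|e|+4}` the program `⟨e, bin n⟩` witnesses
`K^{n^3}(x) ≤ 2|e| + 2 + ⌊log₂ n⌋ + 1 < n` (decomp-pnenp cell N28, decided bottom of the dial; port of
lens-3 g7 `not_explicitStd_id_of_le le_rfl`, 2026-08-30). -/
theorem bottomRefuted33_proof :
    Summit.PneNP.PneNP.Theses.RootDecompExplicitRandom.BottomRefuted33 := by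
  unfold Summit.PneNP.PneNP.Theses.RootDecompExplicitRandom.BottomRefuted33
  rintro ⟨e, n₀, he⟩
  set C : ℕ := 2 * e.length + 3 with hC
  set n : ℕ := max n₀ (2 ^ (C + 1)) with hn
  have hn0 : n₀ ≤ n := le_max_left _ _
  have hnC : 2 ^ (C + 1) ≤ n := le_max_right _ _
  have hCpos : 0 < 2 ^ (C + 1) := by positivity
  have hnne : n ≠ 0 := by omega
  obtain ⟨x, hrun, -, hK⟩ := he n hn0
  -- the constructing program is itself a description of `x` within `n ^ 3` rounds
  have h1 : (⨅ (prog : List Bool) (_ : ClockedUS.run prog (n ^ 3) = some x), (prog.length : ℕ∞)) ≤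
      ((boolPair e ((Nat.digits 2 n).map fun d => decide (d = 1))).length : ℕ∞) :=
    iInf₂_le (boolPair e ((Nat.digits 2 n).map fun d => decide (d = 1))) hrun
  have h2 : ((Nat.digits 2 n).map fun d => decide (d = 1)).length = Nat.log 2 n + 1 := by
    rw [List.length_map, Nat.length_digits 2 n (by norm_num) hnne]
  have h3 : n ≤ 2 * e.length + 2 + (Nat.log 2 n + 1) := by
    have h := hK.trans h1
    rw [length_boolPair, h2] at h
    have h' : ((n : ℕ) : ℕ∞) ≤ ((2 * e.length + 2 + (Nat.log 2 n + 1) : ℕ) : ℕ∞) := by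
      simpa only [id] using h
    exact_mod_cast h'
  -- arithmetic: `⌊log₂ n⌋ + C < n` once `n ≥ 2 ^ (C + 1)`
  have hm : C + 1 ≤ Nat.log 2 n := Nat.le_log_of_pow_le (by norm_num) hnC
  have hpow : 2 ^ Nat.log 2 n ≤ n := Nat.pow_log_le_self 2 hnne
  obtain ⟨k, hk⟩ : ∃ k, Nat.log 2 n = k + 1 := ⟨Nat.log 2 n - 1, by omega⟩
  have hk2 : k < 2 ^ k := Nat.lt_two_pow_self
  have hpk : 2 ^ Nat.log 2 n = 2 * 2 ^ k := by rw [hk, pow_succ]; ring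
  omega

end Summit.PneNP.PneNP.Theorems
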